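import Mathlib
import Summits.Ventures.LatticeQCDFlow.TrivializingMaps.SlotCasimir
import Summits.Ventures.LatticeQCDFlow.TrivializingMaps.JointGrading

/-!
# The slot representation on the Hilbert space `ℓ²(σ → Fin n)`: unitarity, skew generators,
# self-adjoint commuting Casimirs, and the joint Casimir grading

HONEST FRAMING. Exact (Metropolis-corrected) sampling algorithms for lattice gauge theory; figures of
merit are autocorrelation/cost numbers at stated couplings and volumes; no continuum-physics claim.
This file is finite-dimensional linear algebra only.

We transport the matrix-level objects of `SlotRepresentation` / `SlotCasimir` to continuous linear
maps of the Hilbert space `SlotSpace σ n := EuclideanSpace ℂ (σ → Fin n)` through Mathlib's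
star-algebra equivalence `Matrix.toEuclideanCLM`, and instantiate the abstract theory of
`CasimirGrading` / `JointGrading` (THEORY-1 §19.2 (E1)–(E3), (E6)):

* `norm_toE_apply_of_mem_unitary`, `repCLM_norm_le` : `R_σ(U)` is an isometry, `‖R_σ(U)‖ ≤ 1`;
* `adjoint_genCLM` : `T^{σ,e}_Y` is skew-adjoint for `Y ∈ 𝔰𝔲(n)`;
* `casimirCLM_eq_casimir` : `C^{σ,e}` is the abstract Casimir `∑ₐ (T_a^{σ,e})† T_a^{σ,e}` of
  `CasimirGrading.casimir`; hence (E2) `∑ₐ ‖T_a^{σ,e} w‖² = Re⟪w, C^{σ,e} w⟫`;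
* `isSelfAdjoint_casimirCLM`, `casimirCLM_comm`, `repCLM_comm_casimirCLM`, `genCLM_comm_casimirCLM` :
  the hypotheses of `JointGrading.isGrading_jointProj` / `JointGrading.jointProj_comm`;
* `isGrading_slotJointProj`, `slotJointProj_comm_repCLM`, `slotJointProj_comm_genCLM` : the joint
  Casimir grading `(P_m)_m` of `SlotSpace σ n` is an `IsGrading` commuting with `R_σ(U)` (for
  unitary `U`) and with every `T^{σ,e'}_Y`, `Y ∈ 𝔰𝔲(n)` — the re-grading step of §19.3 at cost 1.
[folklore linear algebra; ours: the packaging]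
-/

namespace Summit.Ventures.LatticeQCDFlow.TrivializingMaps.SlotHilbert

open Literature.MathematicalPhysics.QuantumFieldTheory
open Literature.MathematicalPhysics.QuantumFieldTheory.Luscher2010
open SlotRepresentation SlotCasimir CasimirGrading JointGrading
open scoped ComplexConjugate InnerProductSpace Matrix

variable {n : ℕ} {σ : Type*} [Fintype σ] [DecidableEq σ] {E : Type*}

/-! ## 1. Matrices as operators on `ℓ²(σ → Fin n)` -/

/-- The slot Hilbert space `ℓ²(σ → Fin n) ≅ (ℂⁿ)^{⊗σ}`. [folklore] -/
abbrev SlotSpace (σ : Type*) (n : ℕ) [Fintype σ] [DecidableEq σ] : Type _ :=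
  EuclideanSpace ℂ (σ → Fin n)

/-- A slot matrix as a continuous linear map of `SlotSpace σ n` (Mathlib's `Matrix.toEuclideanCLM`).
[folklore] -/
noncomputable abbrev toE (A : Matrix (σ → Fin n) (σ → Fin n) ℂ) : SlotSpace σ n →L[ℂ] SlotSpace σ n :=
  Matrix.toEuclideanCLM (n := σ → Fin n) (𝕜 := ℂ) A

/-- `toE` is multiplicative. [folklore] -/
theorem toE_mul (A A' : Matrix (σ → Fin n) (σ → Fin n) ℂ) : toE (A * A') = toE A ∘L toE A' := by
  unfold toE; rw [map_mul]; rfl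

/-- `toE` is additive: negation. [folklore] -/
theorem toE_neg (A : Matrix (σ → Fin n) (σ → Fin n) ℂ) : toE (-A) = -toE A := by
  unfold toE; exact map_neg _ A

/-- `toE` is additive: finite sums. [folklore] -/
theorem toE_sum {κ : Type*} (s : Finset κ) (A : κ → Matrix (σ → Fin n) (σ → Fin n) ℂ) :
    toE (∑ i ∈ s, A i) = ∑ i ∈ s, toE (A i) := by
  unfold toE; exact map_sum _ A s

/-- `toE 1 = 1`. [folklore] -/
theorem toE_one : toE (1 : Matrix (σ → Fin n) (σ → Fin n) ℂ) = 1 := by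
  unfold toE; exact map_one _

/-- `toE` of the conjugate transpose is the adjoint. [folklore] -/
theorem toE_conjTranspose (A : Matrix (σ → Fin n) (σ → Fin n) ℂ) :
    toE Aᴴ = ContinuousLinearMap.adjoint (toE A) := by
  unfold toE
  rw [← Matrix.star_eq_conjTranspose, map_star, ContinuousLinearMap.star_eq_adjoint]

/-- Skew-Hermitian matrices give skew-adjoint operators. [folklore] -/
theorem adjoint_toE_of_skew {A : Matrix (σ → Fin n) (σ → Fin n) ℂ} (hA : Aᴴ = -A) :
    ContinuousLinearMap.adjoint (toE A) = -toE A := by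
  rw [← toE_conjTranspose, hA, toE_neg]

/-- Hermitian matrices give self-adjoint operators. [folklore] -/
theorem isSelfAdjoint_toE {A : Matrix (σ → Fin n) (σ → Fin n) ℂ} (hA : Aᴴ = A) :
    IsSelfAdjoint (toE A) := by
  rw [ContinuousLinearMap.isSelfAdjoint_iff', ← toE_conjTranspose, hA]

/-- Commuting matrices give commuting operators. [folklore] -/
theorem toE_comm {A A' : Matrix (σ → Fin n) (σ → Fin n) ℂ} (h : A * A' = A' * A) :
    toE A ∘L toE A' = toE A' ∘L toE A := by
  rw [← toE_mul, ← toE_mul, h]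

/-- A unitary matrix acts isometrically. [folklore] -/
theorem norm_toE_apply_of_mem_unitary {U : Matrix (σ → Fin n) (σ → Fin n) ℂ}
    (hU : U ∈ Matrix.unitaryGroup (σ → Fin n) ℂ) (v : SlotSpace σ n) : ‖toE U v‖ = ‖v‖ := by
  have h1 : ContinuousLinearMap.adjoint (toE U) ∘L toE U = 1 := by
    rw [← toE_conjTranspose, ← toE_mul, ← Matrix.star_eq_conjTranspose,
      Matrix.mem_unitaryGroup_iff'.1 hU, toE_one]
  have h1v : ContinuousLinearMap.adjoint (toE U) (toE U v) = v := by
    have h := congrArg (fun F : SlotSpace σ n →L[ℂ] SlotSpace σ n => F v) h1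
    simpa using h
  have h2 : ‖toE U v‖ ^ 2 = ‖v‖ ^ 2 := by
    rw [← inner_self_eq_norm_sq (𝕜 := ℂ), ← inner_self_eq_norm_sq (𝕜 := ℂ),
      ← ContinuousLinearMap.adjoint_inner_left (toE U) v (toE U v), h1v]
  exact (sq_eq_sq₀ (norm_nonneg _) (norm_nonneg _)).1 h2

/-- A unitary matrix has operator norm `≤ 1`. [folklore] -/
theorem norm_toE_le_one_of_mem_unitary {U : Matrix (σ → Fin n) (σ → Fin n) ℂ}
    (hU : U ∈ Matrix.unitaryGroup (σ → Fin n) ℂ) : ‖toE U‖ ≤ 1 :=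
  ContinuousLinearMap.opNorm_le_bound _ zero_le_one fun v => by
    rw [norm_toE_apply_of_mem_unitary hU, one_mul]

/-! ## 2. The slot representation, its generators and Casimirs as operators -/

section Ops
variable (lnk : σ → E) (pol : σ → Bool)

/-- `R_σ(W)` as an operator. [ours] -/
noncomputable abbrev repCLM (W : E → Matrix (Fin n) (Fin n) ℂ) :
    SlotSpace σ n →L[ℂ] SlotSpace σ n :=
  toE (slotRep lnk pol W)

/-- (E1) `R_σ(U)` is an isometry for unitary `U`. [folklore] -/
theorem norm_repCLM_apply {U : E → Matrix (Fin n) (Fin n) ℂ}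
    (hU : ∀ e, U e ∈ Matrix.unitaryGroup (Fin n) ℂ) (v : SlotSpace σ n) :
    ‖repCLM lnk pol U v‖ = ‖v‖ :=
  norm_toE_apply_of_mem_unitary (slotRep_mem_unitaryGroup lnk pol hU) v

/-- (E1) `‖R_σ(U)‖ ≤ 1` for unitary `U`. [folklore] -/
theorem repCLM_norm_le {U : E → Matrix (Fin n) (Fin n) ℂ}
    (hU : ∀ e, U e ∈ Matrix.unitaryGroup (Fin n) ℂ) : ‖repCLM lnk pol U‖ ≤ 1 :=
  norm_toE_le_one_of_mem_unitary (slotRep_mem_unitaryGroup lnk pol hU)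

variable [DecidableEq E]

/-- `T^{σ,e}_Y` as an operator. [ours] -/
noncomputable abbrev genCLM (e : E) (Y : Matrix (Fin n) (Fin n) ℂ) :
    SlotSpace σ n →L[ℂ] SlotSpace σ n :=
  toE (slotGen lnk pol e Y)

/-- `C^{σ,e}` as an operator. [ours] -/
noncomputable abbrev casimirCLM (B : SuBasis n) (e : E) : SlotSpace σ n →L[ℂ] SlotSpace σ n :=
  toE (casimirM B lnk pol e)

/-- The generators are skew-adjoint for skew-Hermitian `Y`. [folklore] -/
theorem adjoint_genCLM (e : E) {Y : Matrix (Fin n) (Fin n) ℂ} (hY : Yᴴ = -Y) :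
    ContinuousLinearMap.adjoint (genCLM lnk pol e Y) = -genCLM lnk pol e Y :=
  adjoint_toE_of_skew (slotGen_conjTranspose_of_skew lnk pol e hY)

variable (B : SuBasis n)

/-- `C^{σ,e}` IS the abstract Casimir `∑ₐ (T_a^{σ,e})† T_a^{σ,e}` of `CasimirGrading`. [ours] -/
theorem casimirCLM_eq_casimir (e : E) :
    casimirCLM lnk pol B e = casimir (fun a => genCLM lnk pol e (B.T a)) := by
  have h : ∀ a, ContinuousLinearMap.adjoint (genCLM lnk pol e (B.T a)) ∘L genCLM lnk pol e (B.T a)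
      = -toE (slotGen lnk pol e (B.T a) * slotGen lnk pol e (B.T a)) := fun a => by
    rw [adjoint_genCLM lnk pol e (skew_T B a), ContinuousLinearMap.neg_comp, toE_mul]
  simp only [casimir, h]
  show toE (casimirM B lnk pol e) = _
  rw [casimirM, toE_neg, toE_sum, Finset.sum_neg_distrib]

/-- (E2, identity) `∑ₐ ‖T_a^{σ,e} w‖² = Re⟪w, C^{σ,e} w⟫`. [folklore] -/
theorem sum_norm_genCLM_sq (e : E) (w : SlotSpace σ n) :
    ∑ a, ‖genCLM lnk pol e (B.T a) w‖ ^ 2 = RCLike.re ⟪w, casimirCLM lnk pol B e w⟫_ℂ := by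
  rw [casimirCLM_eq_casimir, re_inner_casimir_self]

/-- (E2, on an eigenvector) `C^{σ,e} w = c•w ⇒ ∑ₐ ‖T_a^{σ,e} w‖² = c‖w‖²`. [folklore] -/
theorem sum_norm_genCLM_sq_of_eigen (e : E) {w : SlotSpace σ n} {c : ℝ}
    (hw : casimirCLM lnk pol B e w = (c : ℂ) • w) :
    ∑ a, ‖genCLM lnk pol e (B.T a) w‖ ^ 2 = c * ‖w‖ ^ 2 := by
  rw [casimirCLM_eq_casimir] at hw
  rw [← re_inner_casimir_of_eigen _ hw, ← casimirCLM_eq_casimir, sum_norm_genCLM_sq]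

/-- (E2, single generator) `‖T_a^{σ,e} w‖ ≤ √c ‖w‖` on a `C^{σ,e}`-eigenvector. [folklore] -/
theorem norm_genCLM_le_of_eigen (e : E) (a : B.ι) {w : SlotSpace σ n} {c : ℝ}
    (hw : casimirCLM lnk pol B e w = (c : ℂ) • w) :
    ‖genCLM lnk pol e (B.T a) w‖ ≤ Real.sqrt c * ‖w‖ := by
  rw [casimirCLM_eq_casimir] at hw
  exact norm_apply_le_sqrt_mul_norm _ a hw

/-- `C^{σ,e}` is self-adjoint. [folklore] -/
theorem isSelfAdjoint_casimirCLM (e : E) : IsSelfAdjoint (casimirCLM lnk pol B e) :=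
  isSelfAdjoint_toE (casimirM_conjTranspose B lnk pol e)

/-- (E6a) The slot Casimirs commute. [ours] -/
theorem casimirCLM_comm (e e' : E) :
    casimirCLM lnk pol B e ∘L casimirCLM lnk pol B e' = casimirCLM lnk pol B e' ∘L casimirCLM lnk pol B e :=
  toE_comm (casimirM_comm B lnk pol e e')

/-- (E6c) `R_σ(U)` commutes with every slot Casimir (unitary `U`). [ours] -/
theorem repCLM_comm_casimirCLM {U : E → Matrix (Fin n) (Fin n) ℂ}
    (hU : ∀ e, U e ∈ Matrix.unitaryGroup (Fin n) ℂ) (e : E) :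
    repCLM lnk pol U ∘L casimirCLM lnk pol B e = casimirCLM lnk pol B e ∘L repCLM lnk pol U :=
  toE_comm (casimirM_comm_slotRep B lnk pol U hU e).symm

/-- (E6b) Every generator `T^{σ,e'}_Y`, `Y ∈ 𝔰𝔲(n)`, commutes with every slot Casimir. [ours] -/
theorem genCLM_comm_casimirCLM (e e' : E) {Y : Matrix (Fin n) (Fin n) ℂ} (hY : Y ∈ suAlgebra n) :
    genCLM lnk pol e' Y ∘L casimirCLM lnk pol B e = casimirCLM lnk pol B e ∘L genCLM lnk pol e' Y :=
  toE_comm (casimirM_comm_slotGen B lnk pol e e' hY).symm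

end Ops

/-! ## 3. The joint Casimir grading of the slot space -/

section Joint
variable [DecidableEq E] (lnk : σ → E) (pol : σ → Bool) (B : SuBasis n)

/-- The family of slot Casimirs `e ↦ C^{σ,e}`. [ours] -/
noncomputable abbrev casimirFamily : E → SlotSpace σ n →L[ℂ] SlotSpace σ n :=
  fun e => casimirCLM lnk pol B e

/-- (E3/G1) The joint Casimir projections form a grading of the slot space. [ours] -/
theorem isGrading_slotJointProj [Fintype E] : IsGrading (jointProj (casimirFamily lnk pol B)) :=
  isGrading_jointProj _ (fun e => isSelfAdjoint_casimirCLM lnk pol B e)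
    (fun e e' => casimirCLM_comm lnk pol B e e')

/-- (G2 with E6c) `R_σ(U)` commutes with every joint projection (unitary `U`). [ours] -/
theorem slotJointProj_comm_repCLM {U : E → Matrix (Fin n) (Fin n) ℂ}
    (hU : ∀ e, U e ∈ Matrix.unitaryGroup (Fin n) ℂ) (m : Modes (casimirFamily lnk pol B)) :
    jointProj (casimirFamily lnk pol B) m ∘L repCLM lnk pol U
      = repCLM lnk pol U ∘L jointProj (casimirFamily lnk pol B) m :=
  jointProj_comm _ (fun e => isSelfAdjoint_casimirCLM lnk pol B e)
    (fun e => repCLM_comm_casimirCLM lnk pol B hU e) m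

/-- (G2 with E6b) every generator `T^{σ,e'}_Y`, `Y ∈ 𝔰𝔲(n)`, commutes with every joint projection.
[ours] -/
theorem slotJointProj_comm_genCLM (e' : E) {Y : Matrix (Fin n) (Fin n) ℂ} (hY : Y ∈ suAlgebra n)
    (m : Modes (casimirFamily lnk pol B)) :
    jointProj (casimirFamily lnk pol B) m ∘L genCLM lnk pol e' Y
      = genCLM lnk pol e' Y ∘L jointProj (casimirFamily lnk pol B) m :=
  jointProj_comm _ (fun e => isSelfAdjoint_casimirCLM lnk pol B e)
    (fun e => genCLM_comm_casimirCLM lnk pol B e e' hY) m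

/-- (G3) on the range of `P_m` each `C^{σ,e}` acts as the real scalar `m_e`. [ours] -/
theorem casimirCLM_jointProj (m : Modes (casimirFamily lnk pol B)) (e : E) (v : SlotSpace σ n) :
    casimirCLM lnk pol B e (jointProj (casimirFamily lnk pol B) m v)
      = ((m e : ℂ).re : ℂ) • jointProj (casimirFamily lnk pol B) m v := by
  rw [← mode_eq_re _ (fun e => isSelfAdjoint_casimirCLM lnk pol B e) m e]
  exact apply_jointProj (casimirFamily lnk pol B) e m v

/-- (G4) the modes are nonnegative: `0 ≤ m_e`. [ours] -/
theorem slotMode_nonneg (m : Modes (casimirFamily lnk pol B)) (e : E) : 0 ≤ (m e : ℂ).re :=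
  mode_nonneg _ (X := fun a => genCLM lnk pol e (B.T a)) e (casimirCLM_eq_casimir lnk pol B e) m

/-- (E2 on a joint mode) `‖T_a^{σ,e} P_m v‖ ≤ √(m_e) ‖P_m v‖`. [ours] -/
theorem norm_genCLM_jointProj_le (m : Modes (casimirFamily lnk pol B)) (e : E) (a : B.ι)
    (v : SlotSpace σ n) :
    ‖genCLM lnk pol e (B.T a) (jointProj (casimirFamily lnk pol B) m v)‖
      ≤ Real.sqrt (m e : ℂ).re * ‖jointProj (casimirFamily lnk pol B) m v‖ :=
  norm_genCLM_le_of_eigen lnk pol B e a (casimirCLM_jointProj lnk pol B m e v)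

/-- **Re-grading identity** for slot matrix coefficients (unitary `U`):
`⟪R_σ(U) v, w⟫ = ∑_m ⟪R_σ(U) P_m v, P_m w⟫`. [ours] -/
theorem inner_repCLM_eq_sum [Fintype E] {U : E → Matrix (Fin n) (Fin n) ℂ}
    (hU : ∀ e, U e ∈ Matrix.unitaryGroup (Fin n) ℂ) (v w : SlotSpace σ n) :
    ⟪repCLM lnk pol U v, w⟫_ℂ = ∑ m : Modes (casimirFamily lnk pol B),
      ⟪repCLM lnk pol U (jointProj (casimirFamily lnk pol B) m v),
        jointProj (casimirFamily lnk pol B) m w⟫_ℂ :=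
  inner_eq_sum_jointProj _ (fun e => isSelfAdjoint_casimirCLM lnk pol B e)
    (fun e e' => casimirCLM_comm lnk pol B e e') (fun e => repCLM_comm_casimirCLM lnk pol B hU e) v w

/-- **Re-grading costs 1** (E3): `∑_m ‖R_σ(U) P_m v‖ ‖P_m w‖ ≤ ‖v‖ ‖w‖` for unitary `U`. [ours] -/
theorem sum_norm_repCLM_jointProj_le [Fintype E] {U : E → Matrix (Fin n) (Fin n) ℂ}
    (hU : ∀ e, U e ∈ Matrix.unitaryGroup (Fin n) ℂ) (v w : SlotSpace σ n) :
    ∑ m : Modes (casimirFamily lnk pol B),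
      ‖repCLM lnk pol U (jointProj (casimirFamily lnk pol B) m v)‖
        * ‖jointProj (casimirFamily lnk pol B) m w‖ ≤ ‖v‖ * ‖w‖ := by
  calc ∑ m : Modes (casimirFamily lnk pol B),
      ‖repCLM lnk pol U (jointProj (casimirFamily lnk pol B) m v)‖
        * ‖jointProj (casimirFamily lnk pol B) m w‖
      = ∑ m : Modes (casimirFamily lnk pol B), ‖jointProj (casimirFamily lnk pol B) m v‖
        * ‖jointProj (casimirFamily lnk pol B) m w‖ :=
        Finset.sum_congr rfl fun m _ => by rw [norm_repCLM_apply lnk pol hU]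
    _ ≤ ‖v‖ * ‖w‖ := (isGrading_slotJointProj lnk pol B).sum_norm_mul_norm_le v w

end Joint

end Summit.Ventures.LatticeQCDFlow.TrivializingMaps.SlotHilbert
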